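import Mathlib.Tactic.DeriveFintype
import Literature.Computability.Complexity.SymbolPrograms
import Literature.Computability.Complexity.Classes
import Literature.Computability.Complexity.NSubexp
import HarnessLib

/-!
# Exponential padding: the pad `x ↦ 1^{2^{|x|^k}} 0 x` is computable in time `O(2^{n^k})`;
# padded languages; upward translation `pad(L) ∈ P ⟹ L ∈ EXP` (trunk CplxCore)

Padding arguments ("translation upward": Arora–Barak 2009, §2.6.2, proof of Thm. 2.22
"`EXP ≠ NEXP ⟹ P ≠ NP`"; Murray–Williams 2017, proof of Thm. 4.1: "Define the padded language
`L' := {x01^{2^{|x|^c}} | x ∈ L}` … It is enough to show that `L ∈ EXP`") move a language of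
exponential complexity down to a *sparse* language of polynomial complexity and back. On the
tree's machine model (Mathlib's multi-stack machines `Turing.FinTM2`, classes `DTIME`/`P`/`EXP` of
`Classes.lean`) the way back needs an honest exponential-time machine — the pad has exponential
length — and the tree so far had none (its machine toolkits `StackMachines`/`StackPrograms`/
`CoinTruncation`/… all package *polynomial* cost). This file supplies it:

* `expPad k x = 1^{2^{|x|^k}} ++ 0 :: x` (pad first, so that machines meet the pad before the
  payload; the order is immaterial for the cited arguments), `length_expPad`, `expPad_injective`;
* `ExpPad.prog k` — a structured stack program over the alphabet `Bool` (`ACom`,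
  `SymbolPrograms.lean`: exact cost semantics `ACom.Runs`, compiled to `FinTM2` by
  `ACom.exists_computesInTime`) computing `expPad k`: split the input into a reversed copy and a
  unary length `1ⁿ` (`split`), `k` unary multiplications give `1^{n^k}` (`addU`, `mulStep`,
  `powLoop`), `n^k` doublings give `1^{2^{n^k}}` (`dbl`, the loop `runs_expLoop` with the exact
  geometric cost `cExp`), and the output is assembled (`finish`); `ExpPad.runs_prog` is its
  specification with the exact cost `cProg k n`, and `ExpPad.exists_cProg_le`:
  `cProg k n + 1 ≤ C · 2^{n^k} + C` for `1 ≤ k`;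
* `exists_computesInTime_expPad`, **`exists_timeComputable_expPad`**: `expPad k` is
  `TimeComputable id id` in time `C · 2^{n^k} + C` (`1 ≤ k`);
* `padLang k L = expPad k '' L`, `expPad_mem_padLang_iff`, and sparseness
  **`ncard_padLang_slice_le`**: at most `N` words of each length `N` (`1 ≤ k`);
* upward translation: **`exists_timeDecidable_of_expPad`** (pad, then run the decider of the
  padded language: `Turing.TM2ComputableAux.comp_outputsWithin`, additive time),
  **`mem_DTIME_of_expPad`** (`L' ∈ DTIME(n^j) ⟹ L ∈ DTIME(2^{n^{k+1}})`),
  **`mem_EXP_of_expPad`**, **`mem_EXP_of_padLang_mem_P`** (`padLang k L ∈ P ⟹ L ∈ EXP`).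

First client: the decomposition of Murray–Williams 2017, Thm. 4.1 (the named fact
`Literature.Barriers.PneNP.MurrayWilliams2017_thm_4_1`, `Barriers/PneNP/MCSPHardnessObstructions.lean`),
whose printed proof pads `L ∈ NTIME(2^{n^c})` to a sparse `NP` language and concludes `L ∈ EXP`
from a polynomial-time procedure on the pads.

## Design notes

* Stores of the program are written with the record-like `ExpPad.mk` (one argument per
  register) and its `Function.update`/read-out `simp` lemmas, so that every routine has a
  specification `runs_*` by `ExpPad.mk`-patterns; loops are instances of `ACom.runs_loop_inv`
  except the doubling loop, whose per-iteration cost grows and which is done by induction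
  (`runs_expLoop`, cost `cExp N s` with `cExp N s + 10 s = 10 s 2^N + 4 N + 1`).
* All unary registers hold `1`-tokens only (`ExpPad.un n = replicate n true`), so pours
  (which reverse) are harmless.
* The exponent `k = 0` is allowed in the program but the `O(2^{n^k})` bound and the
  translation lemmas assume `1 ≤ k` (for `k = 0` the pad has constant length).

## References

* S. Arora, B. Barak, *Computational Complexity: A Modern Approach*, CUP 2009, §2.6.2,
  Thm. 2.22 and its proof (padding; "translating upward"), §1.3 (machine constructions).
* C. D. Murray, R. R. Williams, *On the (non) NP-hardness of computing circuit complexity*,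
  Theory of Computing 13 (2017), proof of Thm. 4.1 (p. 14) = CCC 2015, pp. 374–375.
* T. Nipkow, G. Klein, *Concrete Semantics with Isabelle/HOL*, Springer 2014, Ch. 7 (big-step
  cost semantics; the loop rule with an invariant) — the verification style of `SymbolPrograms`.
-/

namespace Literature.Computability.Complexity

open _root_.Computability

/-! ### The exponential pad -/

/-- **The exponential pad** `expPad k x = 1^{2^{|x|^k}} 0 x`. [folklore] -/
def expPad (k : ℕ) (x : List Bool) : List Bool :=
  List.replicate (2 ^ (x.length ^ k)) true ++ false :: x

/-- Length of the pad: `|expPad k x| = 2^{|x|^k} + |x| + 1`. [folklore] -/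
@[simp] theorem length_expPad (k : ℕ) (x : List Bool) :
    (expPad k x).length = 2 ^ (x.length ^ k) + x.length + 1 := by
  simp [expPad]; omega

namespace ExpPad

open ACom

/-! ### Registers and stores -/

/-- Registers of the padding program: input `inp` and output `out` are the input and output
stacks of the compiled machine; `xr` holds the reversed input, `u` its length in unary (`u2` a
scratch copy), `p` the unary power being built (`q` its scratch), `e` the unary exponential
(`f` its scratch). [folklore] -/
inductive Rg
  | inp | xr | u | u2 | p | q | e | f | out
  deriving DecidableEq, Fintype

/-- Stores of the padding program. [folklore] -/
abbrev Store : Type := AStore Bool Rg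

/-- Programs over the registers `Rg` and the alphabet `Bool`. [folklore] -/
abbrev Prog : Type := ACom Bool Rg

/-- The store with prescribed register contents. [folklore] -/
def mk (inp xr u u2 p q e f out : List Bool) : Store
  | .inp => inp
  | .xr => xr
  | .u => u
  | .u2 => u2
  | .p => p
  | .q => q
  | .e => e
  | .f => f
  | .out => out

section MkLemmas

variable (i xr u u2 p q e f o v : List Bool)

/-- Read-out of `inp`. [folklore] -/
@[simp] theorem mk_inp : mk i xr u u2 p q e f o .inp = i := rfl
/-- Read-out of `xr`. [folklore] -/
@[simp] theorem mk_xr : mk i xr u u2 p q e f o .xr = xr := rfl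
/-- Read-out of `u`. [folklore] -/
@[simp] theorem mk_u : mk i xr u u2 p q e f o .u = u := rfl
/-- Read-out of `u2`. [folklore] -/
@[simp] theorem mk_u2 : mk i xr u u2 p q e f o .u2 = u2 := rfl
/-- Read-out of `p`. [folklore] -/
@[simp] theorem mk_p : mk i xr u u2 p q e f o .p = p := rfl
/-- Read-out of `q`. [folklore] -/
@[simp] theorem mk_q : mk i xr u u2 p q e f o .q = q := rfl
/-- Read-out of `e`. [folklore] -/
@[simp] theorem mk_e : mk i xr u u2 p q e f o .e = e := rfl
/-- Read-out of `f`. [folklore] -/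
@[simp] theorem mk_f : mk i xr u u2 p q e f o .f = f := rfl
/-- Read-out of `out`. [folklore] -/
@[simp] theorem mk_out : mk i xr u u2 p q e f o .out = o := rfl

/-- Update of `inp`. [folklore] -/
@[simp] theorem update_mk_inp :
    Function.update (mk i xr u u2 p q e f o) .inp v = mk v xr u u2 p q e f o := by
  funext r; cases r <;> rfl
/-- Update of `xr`. [folklore] -/
@[simp] theorem update_mk_xr :
    Function.update (mk i xr u u2 p q e f o) .xr v = mk i v u u2 p q e f o := by
  funext r; cases r <;> rfl
/-- Update of `u`. [folklore] -/
@[simp] theorem update_mk_u :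
    Function.update (mk i xr u u2 p q e f o) .u v = mk i xr v u2 p q e f o := by
  funext r; cases r <;> rfl
/-- Update of `u2`. [folklore] -/
@[simp] theorem update_mk_u2 :
    Function.update (mk i xr u u2 p q e f o) .u2 v = mk i xr u v p q e f o := by
  funext r; cases r <;> rfl
/-- Update of `p`. [folklore] -/
@[simp] theorem update_mk_p :
    Function.update (mk i xr u u2 p q e f o) .p v = mk i xr u u2 v q e f o := by
  funext r; cases r <;> rfl
/-- Update of `q`. [folklore] -/
@[simp] theorem update_mk_q :
    Function.update (mk i xr u u2 p q e f o) .q v = mk i xr u u2 p v e f o := by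
  funext r; cases r <;> rfl
/-- Update of `e`. [folklore] -/
@[simp] theorem update_mk_e :
    Function.update (mk i xr u u2 p q e f o) .e v = mk i xr u u2 p q v f o := by
  funext r; cases r <;> rfl
/-- Update of `f`. [folklore] -/
@[simp] theorem update_mk_f :
    Function.update (mk i xr u u2 p q e f o) .f v = mk i xr u u2 p q e v o := by
  funext r; cases r <;> rfl
/-- Update of `out`. [folklore] -/
@[simp] theorem update_mk_out :
    Function.update (mk i xr u u2 p q e f o) .out v = mk i xr u u2 p q e f v := by
  funext r; cases r <;> rfl

end MkLemmas

/-- The initial store. [folklore] -/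
theorem single_inp (x : List Bool) : AStore.single .inp x = mk x [] [] [] [] [] [] [] [] := by
  funext r; cases r <;> rfl

/-- The final store. [folklore] -/
theorem single_out (w : List Bool) : AStore.single .out w = mk [] [] [] [] [] [] [] [] w := by
  funext r; cases r <;> rfl

/-- Unary words. [folklore] -/
abbrev un (n : ℕ) : List Bool := List.replicate n true

/-! ### Stage 1: split the input into a reversed copy and a unary length -/

/-- `split`: pop the input, pushing each symbol on `xr` and a token on `u`. [folklore] -/
def split : Prog := loop .inp fun b => push .xr b ;; push .u true

/-- Effect and cost of `split`. [folklore] -/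
theorem runs_split (x : List Bool) :
    Runs split (mk x [] [] [] [] [] [] [] []) (mk [] x.reverse (un x.length) [] [] [] [] [] [])
      (4 * x.length + 1) := by
  have h := runs_loop_inv (k := Rg.inp) (f := fun b => push .xr b ;; push .u true)
    (fun done rest => mk rest done (un done.length) [] [] [] [] [] [])
    (fun _ _ => True) 2
    (fun _ _ _ => rfl)
    (fun done a rest _ => ⟨trivial, by
      refine ((Runs.push' rfl).seq (Runs.push' ?_)).of_eq rfl (by norm_num)
      simp [un, List.replicate_succ]⟩)
    x [] trivial
  unfold split
  simpa using h

/-! ### Stage 2: the unary power `|x|^k` -/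

/-- `addU`: add `|u|` tokens to `q`, keeping `u` (via the scratch register `u2`). [folklore] -/
def addU : Prog := loop .u (fun _ => push .q true ;; push .u2 true) ;; pour .u2 .u

/-- Effect and cost of `addU`: `q := 1^m ++ q` for `u = 1^m`. [folklore] -/
theorem runs_addU (i xr p q e f o : List Bool) (m : ℕ) :
    Runs addU (mk i xr (un m) [] p q e f o) (mk i xr (un m) [] p (un m ++ q) e f o) (7 * m + 2) := by
  have h := runs_loop_inv (k := Rg.u) (f := fun _ => push .q true ;; push .u2 true)
    (fun done rest => mk i xr rest (un done.length) p (un done.length ++ q) e f o)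
    (fun _ _ => True) 2
    (fun _ _ _ => rfl)
    (fun done a rest _ => ⟨trivial, by
      refine ((Runs.push' rfl).seq (Runs.push' ?_)).of_eq rfl (by norm_num)
      simp [un, List.replicate_succ]⟩)
    (un m) [] trivial
  have h2 := runs_pour (Γ := Bool) (a := Rg.u2) (b := Rg.u) (by decide)
    (mk i xr [] (un m) p (un m ++ q) e f o)
  have h2' : Runs (pour Rg.u2 Rg.u) (mk i xr [] (un m) p (un m ++ q) e f o)
      (mk i xr (un m) [] p (un m ++ q) e f o) (3 * m + 1) := by
    simpa [un] using h2
  have h' : Runs (loop Rg.u fun _ => push Rg.q true ;; push Rg.u2 true) (mk i xr (un m) [] p q e f o)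
      (mk i xr [] (un m) p (un m ++ q) e f o) (4 * m + 1) := by
    simpa [un] using h
  unfold addU
  exact (h'.seq h2').of_eq rfl (by omega)

/-- `mulStep`: `p := 1^{a·m}` for `p = 1^a`, `u = 1^m` (repeated `addU`, then pour the result
back). [folklore] -/
def mulStep : Prog := loop .p (fun _ => addU) ;; pour .q .p

/-- Effect and cost of `mulStep`. [folklore] -/
theorem runs_mulStep (i xr e f o : List Bool) (m a : ℕ) :
    Runs mulStep (mk i xr (un m) [] (un a) [] e f o) (mk i xr (un m) [] (un (a * m)) [] e f o)
      ((7 * m + 4) * a + 3 * (a * m) + 2) := by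
  have h := runs_loop_inv (k := Rg.p) (f := fun _ => addU)
    (fun done rest => mk i xr (un m) [] rest (un (done.length * m)) e f o)
    (fun _ _ => True) (7 * m + 2)
    (fun _ _ _ => rfl)
    (fun done a rest _ => ⟨trivial, by
      rw [update_mk_p]
      refine (runs_addU i xr rest (un (done.length * m)) e f o m).of_eq ?_ le_rfl
      simp [un, Nat.succ_mul, Nat.add_comm]⟩)
    (un a) [] trivial
  have h2 := runs_pour (Γ := Bool) (a := Rg.q) (b := Rg.p) (by decide)
    (mk i xr (un m) [] [] (un (a * m)) e f o)
  have h2' : Runs (pour Rg.q Rg.p) (mk i xr (un m) [] [] (un (a * m)) e f o)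
      (mk i xr (un m) [] (un (a * m)) [] e f o) (3 * (a * m) + 1) := by
    simpa [un] using h2
  have h' : Runs (loop Rg.p fun _ => addU) (mk i xr (un m) [] (un a) [] e f o)
      (mk i xr (un m) [] [] (un (a * m)) e f o) ((7 * m + 2 + 2) * a + 1) := by
    simpa [un] using h
  unfold mulStep
  exact (h'.seq h2').of_eq rfl (by ring_nf; omega)

/-- `powLoop k`: `k` multiplication steps. [folklore] -/
def powLoop : ℕ → Prog
  | 0 => skip
  | k + 1 => powLoop k ;; mulStep

/-- Cost of `powLoop k` on `u = 1^m`, `p = 1`. [folklore] -/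
def cPow (m : ℕ) : ℕ → ℕ
  | 0 => 0
  | k + 1 => cPow m k + ((7 * m + 4) * m ^ k + 3 * (m ^ k * m) + 2)

/-- Effect and cost of `powLoop k`: `p := 1^{m^k}`. [folklore] -/
theorem runs_powLoop (i xr e f o : List Bool) (m : ℕ) : ∀ k : ℕ,
    Runs (powLoop k) (mk i xr (un m) [] (un 1) [] e f o) (mk i xr (un m) [] (un (m ^ k)) [] e f o)
      (cPow m k)
  | 0 => by simpa [powLoop, cPow] using Runs.skip (mk i xr (un m) [] (un 1) [] e f o)
  | k + 1 => by
    have h := (runs_powLoop i xr e f o m k).seq (runs_mulStep i xr e f o m (m ^ k))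
    simpa [powLoop, cPow, pow_succ] using h

/-! ### Stage 3: the exponential `2^{|x|^k}` by repeated doubling -/

/-- `dbl`: double the unary register `e` (via the scratch register `f`). [folklore] -/
def dbl : Prog := loop .e (fun _ => push .f true ;; push .f true) ;; pour .f .e

/-- Effect and cost of `dbl`: `e := 1^{2s}` for `e = 1^s`. [folklore] -/
theorem runs_dbl (i xr u u2 p q o : List Bool) (s : ℕ) :
    Runs dbl (mk i xr u u2 p q (un s) [] o) (mk i xr u u2 p q (un (2 * s)) [] o) (10 * s + 2) := by
  have h := runs_loop_inv (k := Rg.e) (f := fun _ => push .f true ;; push .f true)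
    (fun done rest => mk i xr u u2 p q rest (un (2 * done.length)) o)
    (fun _ _ => True) 2
    (fun _ _ _ => rfl)
    (fun done a rest _ => ⟨trivial, by
      refine ((Runs.push' rfl).seq (Runs.push' ?_)).of_eq rfl (by norm_num)
      simp [un, Nat.mul_succ, List.replicate_succ]⟩)
    (un s) [] trivial
  have h2 := runs_pour (Γ := Bool) (a := Rg.f) (b := Rg.e) (by decide)
    (mk i xr u u2 p q [] (un (2 * s)) o)
  have h2' : Runs (pour Rg.f Rg.e) (mk i xr u u2 p q [] (un (2 * s)) o)
      (mk i xr u u2 p q (un (2 * s)) [] o) (3 * (2 * s) + 1) := by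
    simpa [un] using h2
  have h' : Runs (loop Rg.e fun _ => push Rg.f true ;; push Rg.f true) (mk i xr u u2 p q (un s) [] o)
      (mk i xr u u2 p q [] (un (2 * s)) o) (4 * s + 1) := by
    simpa [un] using h
  unfold dbl
  exact (h'.seq h2').of_eq rfl (by omega)

/-- Cost of the doubling loop: `N` doublings starting from `1^s`. [folklore] -/
def cExp : ℕ → ℕ → ℕ
  | 0, _ => 1
  | N + 1, s => 10 * s + 2 + 2 + cExp N (2 * s)

/-- Closed form of `cExp`. [folklore] -/
theorem cExp_eq (N : ℕ) : ∀ s : ℕ, cExp N s + 10 * s = 10 * s * 2 ^ N + 4 * N + 1 := by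
  induction N with
  | zero => intro s; simp [cExp]; ring
  | succ N ih =>
    intro s
    have := ih (2 * s)
    simp only [cExp, pow_succ]
    -- `cExp (N+1) s = 10 s + 4 + cExp N (2 s)` and `cExp N (2s) + 20 s = 20 s 2^N + 4N + 1`
    nlinarith [this]

/-- Effect and cost of the doubling loop `loop p dbl`: `e := 1^{s · 2^N}`, `p := []` for
`p = 1^N`, `e = 1^s`. [folklore] -/
theorem runs_expLoop (i xr u u2 q o : List Bool) : ∀ (N s : ℕ),
    Runs (loop .p fun _ => dbl) (mk i xr u u2 (un N) q (un s) [] o)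
      (mk i xr u u2 [] q (un (s * 2 ^ N)) [] o) (cExp N s)
  | 0, s => by
    simpa [cExp] using Runs.loop_nil (fun _ => dbl) (R := mk i xr u u2 (un 0) q (un s) [] o) rfl
  | N + 1, s => by
    have h1 := runs_dbl i xr u u2 (un N) q o s
    have h2 := runs_expLoop i xr u u2 q o N (2 * s)
    have := Runs.loop_cons (k := Rg.p) (f := fun _ => dbl) (R := mk i xr u u2 (un (N + 1)) q (un s) [] o)
      (a := true) (w := un N) rfl (by simpa using h1) h2
    refine this.of_eq ?_ (by simp [cExp])
    simp [pow_succ]; ring_nf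

/-! ### Stage 4: writing the output -/

/-- `finish`: write `x`, the separator `0` and the unary block to the output; clear `u`.
[folklore] -/
def finish : Prog := pour .xr .out ;; push .out false ;; pour .e .out ;; clear .u

/-- Effect and cost of `finish`. [folklore] -/
theorem runs_finish (x : List Bool) (n E : ℕ) :
    Runs finish (mk [] x.reverse (un n) [] [] [] (un E) [] [])
      (mk [] [] [] [] [] [] [] [] (un E ++ false :: x)) (3 * x.length + 1 + 1 + (3 * E + 1) + (2 * n + 1)) := by
  unfold finish
  have h1 := runs_pour (Γ := Bool) (a := Rg.xr) (b := Rg.out) (by decide)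
    (mk [] x.reverse (un n) [] [] [] (un E) [] [])
  simp only [mk_xr, mk_out, List.reverse_reverse, List.append_nil, update_mk_xr, update_mk_out,
    List.length_reverse] at h1
  have h2 : Runs (push Rg.out false) (mk [] [] (un n) [] [] [] (un E) [] x)
      (mk [] [] (un n) [] [] [] (un E) [] (false :: x)) 1 := Runs.push' (by simp)
  have h3 := runs_pour (Γ := Bool) (a := Rg.e) (b := Rg.out) (by decide)
    (mk [] [] (un n) [] [] [] (un E) [] (false :: x))
  simp only [mk_e, mk_out, update_mk_e, update_mk_out, un, List.reverse_replicate,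
    List.length_replicate] at h3
  have h4 := runs_clear (Γ := Bool) (Rg.u) (mk [] [] (un n) [] [] [] [] [] (un E ++ false :: x))
  simp only [mk_u, update_mk_u, un, List.length_replicate] at h4
  exact (h1.seq (h2.seq (h3.seq h4))).of_eq rfl (by omega)

/-! ### The whole program -/

/-- **The padding program** for exponent `k`. [folklore] -/
def prog (k : ℕ) : Prog :=
  split ;; push .p true ;; powLoop k ;; push .e true ;; (loop .p fun _ => dbl) ;; finish

/-- Cost of the padding program on inputs of length `n`. [folklore] -/
def cProg (k n : ℕ) : ℕ :=
  (4 * n + 1) + 1 + cPow n k + 1 + cExp (n ^ k) 1 + (3 * n + 1 + 1 + (3 * 2 ^ (n ^ k) + 1) + (2 * n + 1))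

/-- **Effect and cost of the padding program**: from the input store holding `x` to the output
store holding `expPad k x`, within `cProg k |x|` steps. [folklore] -/
theorem runs_prog (k : ℕ) (x : List Bool) :
    Runs (prog k) (AStore.single .inp x) (AStore.single .out (expPad k x)) (cProg k x.length) := by
  rw [single_inp, single_out]
  unfold prog cProg
  have h1 := runs_split x
  have h2 : Runs (push Rg.p true) (mk [] x.reverse (un x.length) [] [] [] [] [] [])
      (mk [] x.reverse (un x.length) [] (un 1) [] [] [] []) 1 := Runs.push' (by simp [un])
  have h3 := runs_powLoop [] x.reverse [] [] [] x.length k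
  have h4 : Runs (push Rg.e true) (mk [] x.reverse (un x.length) [] (un (x.length ^ k)) [] [] [] [])
      (mk [] x.reverse (un x.length) [] (un (x.length ^ k)) [] (un 1) [] []) 1 :=
    Runs.push' (by simp [un])
  have h5 := runs_expLoop [] x.reverse (un x.length) [] [] [] (x.length ^ k) 1
  simp only [one_mul] at h5
  have h6 := runs_finish x x.length (2 ^ (x.length ^ k))
  have := h1.seq (h2.seq (h3.seq (h4.seq (h5.seq h6))))
  refine this.of_eq (by rfl) (by omega)

/-! ### The time bound -/

open Polynomial in
/-- The cost of the power stage as a polynomial in the input length. [folklore] -/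
noncomputable def cPowPoly : ℕ → Polynomial ℕ
  | 0 => 0
  | k + 1 => cPowPoly k + ((C 7 * X + C 4) * X ^ k + C 3 * (X ^ k * X) + C 2)

open Polynomial in
/-- `cPowPoly k` evaluates to `cPow n k`. [folklore] -/
theorem eval_cPowPoly (n : ℕ) : ∀ k : ℕ, (cPowPoly k).eval n = cPow n k
  | 0 => by simp [cPowPoly, cPow]
  | k + 1 => by simp [cPowPoly, cPow, eval_cPowPoly n k]

/-- Closed form of the total cost: `cProg k n + 2 = cPow n k + 13 · 2^{n^k} + 4 n^k + 9 n`.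
[folklore] -/
theorem cProg_add_two_eq (k n : ℕ) :
    cProg k n + 2 = cPow n k + 13 * 2 ^ (n ^ k) + 4 * n ^ k + 9 * n := by
  have h := cExp_eq (n ^ k) 1
  have h1 : 1 ≤ 2 ^ (n ^ k) := Nat.one_le_two_pow
  unfold cProg
  omega

/-- **The padding program runs in time `O(2^{n^k})`** (`1 ≤ k`): `cProg k n + 1 ≤ C · 2^{n^k} + C`
for a constant `C` depending on `k`. [folklore] -/
theorem exists_cProg_le (k : ℕ) (hk : 1 ≤ k) :
    ∃ C : ℕ, ∀ n : ℕ, cProg k n + 1 ≤ C * 2 ^ (n ^ k) + C := by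
  open Polynomial in
  obtain ⟨c, hc⟩ := TimeConstructible.exists_poly_le_two_pow_pow
    (cPowPoly k + Polynomial.C 4 * X ^ k + Polynomial.C 9 * X) hk
  refine ⟨c + 13, fun n => ?_⟩
  have h := hc n
  simp only [eval_add, eval_mul, eval_C, eval_pow, eval_X, eval_cPowPoly] at h
  have h2 := cProg_add_two_eq k n
  nlinarith [h, h2, Nat.one_le_two_pow (n := n ^ k)]

end ExpPad

/-! ### The pad is computable in exponential time -/

open ExpPad in
/-- **The exponential pad is computed by a multi-stack machine within `cProg k |x| + 1` steps**
(the structured program `ExpPad.prog k` compiled by `ACom.exists_computesInTime`). [folklore] -/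
theorem exists_computesInTime_expPad (k : ℕ) :
    ∃ M : Turing.TM2ComputableAux Bool Bool,
      ComputesInTime (id : List Bool → List Bool) id (expPad k) (fun x => cProg k x.length + 1) M :=
  ACom.exists_computesInTime (prog k) .inp .out id id (expPad k) (fun x => cProg k x.length)
    (runs_prog k)

/-- **`expPad k` is computable in time `C · 2^{n^k} + C`** (`1 ≤ k`). [folklore] -/
theorem exists_timeComputable_expPad {k : ℕ} (hk : 1 ≤ k) :
    ∃ C : ℕ, TimeComputable (id : List Bool → List Bool) id (expPad k) (fun n => C * 2 ^ (n ^ k) + C) := by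
  obtain ⟨C, hC⟩ := ExpPad.exists_cProg_le k hk
  obtain ⟨M, hM⟩ := exists_computesInTime_expPad k
  exact ⟨C, M, hM.mono fun x => hC x.length⟩

/-! ### Padded languages -/

/-- The function `n ↦ 2^{n^k} + n` is strictly monotone. [folklore] -/
theorem strictMono_two_pow_pow_add (k : ℕ) : StrictMono fun n : ℕ => 2 ^ (n ^ k) + n := by
  refine strictMono_nat_of_lt_succ fun n => ?_
  have : 2 ^ (n ^ k) ≤ 2 ^ ((n + 1) ^ k) :=
    Nat.pow_le_pow_right Nat.two_pos (Nat.pow_le_pow_left (Nat.le_succ n) k)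
  omega

/-- `expPad k` is injective. [folklore] -/
theorem expPad_injective (k : ℕ) : Function.Injective (expPad k) := by
  intro x y h
  have hlen := congrArg List.length h
  simp only [length_expPad] at hlen
  have hxy : x.length = y.length :=
    (strictMono_two_pow_pow_add k).injective (by
      show 2 ^ (x.length ^ k) + x.length = 2 ^ (y.length ^ k) + y.length
      omega)
  have h' := h
  simp only [expPad, hxy] at h'
  simpa using List.append_cancel_left h'

/-- **The padded language** `padLang k L = {expPad k x | x ∈ L} = {1^{2^{|x|^k}} 0 x | x ∈ L}`
(Murray–Williams 2017, proof of Thm. 4.1: "Define the padded language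
`L' := {x01^{2^{|x|^c}} | x ∈ L}`"; the order of pad and payload is immaterial and chosen here
so that machines read the pad first). [cite: MurrayWilliams2017, proof of Thm. 4.1 (p. 14)] -/
def padLang (k : ℕ) (L : Language Bool) : Language Bool :=
  expPad k '' L

/-- Membership of a pad in the padded language. [folklore] -/
@[simp] theorem expPad_mem_padLang_iff {k : ℕ} {L : Language Bool} {x : List Bool} :
    expPad k x ∈ padLang k L ↔ x ∈ L :=
  (expPad_injective k).mem_set_image

/-- Unfolding `padLang`. [folklore] -/
theorem mem_padLang_iff {k : ℕ} {L : Language Bool} {w : List Bool} :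
    w ∈ padLang k L ↔ ∃ x ∈ L, expPad k x = w :=
  Iff.rfl

/-- **Padded languages are sparse**: for `1 ≤ k`, `padLang k L` has at most `N` words of each
length `N` (all words of length `N` in it are pads of words of one and the same length `n`, with
`2ⁿ ≤ 2^{n^k} < N`). (Murray–Williams 2017, proof of Thm. 4.1: "The language `L'` is then a
sparse language".) [cite: MurrayWilliams2017, proof of Thm. 4.1 (p. 14)] -/
theorem ncard_padLang_slice_le {k : ℕ} (hk : 1 ≤ k) (L : Language Bool) (N : ℕ) :
    {w : List Bool | w ∈ padLang k L ∧ w.length = N}.ncard ≤ N := by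
  by_cases hN : ∃ x₀ : List Bool, (expPad k x₀).length = N
  · obtain ⟨x₀, hx₀⟩ := hN
    set n := x₀.length with hn
    have hsub : {w : List Bool | w ∈ padLang k L ∧ w.length = N} ⊆
        (fun v : List.Vector Bool n => expPad k v.toList) '' Set.univ := by
      rintro w ⟨⟨x, -, rfl⟩, hw⟩
      have hxl : x.length = n := by
        rw [← hx₀, length_expPad, length_expPad, ← hn] at hw
        exact (strictMono_two_pow_pow_add k).injective (by
          show 2 ^ (x.length ^ k) + x.length = 2 ^ (n ^ k) + n
          omega)
      exact ⟨⟨x, hxl⟩, Set.mem_univ _, rfl⟩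
    have hfin : ((fun v : List.Vector Bool n => expPad k v.toList) '' Set.univ).Finite :=
      Set.finite_univ.image _
    calc {w : List Bool | w ∈ padLang k L ∧ w.length = N}.ncard
        ≤ ((fun v : List.Vector Bool n => expPad k v.toList) '' Set.univ).ncard :=
          Set.ncard_le_ncard hsub hfin
      _ ≤ (Set.univ : Set (List.Vector Bool n)).ncard := Set.ncard_image_le Set.finite_univ
      _ = 2 ^ n := by
          rw [Set.ncard_univ, Nat.card_eq_fintype_card, card_vector, Fintype.card_bool]
      _ ≤ 2 ^ (n ^ k) := Nat.pow_le_pow_right Nat.two_pos (Nat.le_self_pow (by omega) n)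
      _ ≤ N := by rw [← hx₀, length_expPad, ← hn]; omega
  · have : {w : List Bool | w ∈ padLang k L ∧ w.length = N} = ∅ := by
      ext w
      simp only [Set.mem_setOf_eq, Set.mem_empty_iff_false, iff_false, not_and]
      rintro ⟨x, -, rfl⟩ hlen
      exact hN ⟨x, hlen⟩
    rw [this, Set.ncard_empty]
    exact Nat.zero_le _

/-! ### Upward translation: deciding `L` through its padded version -/

/-- For `1 ≤ k`: `|expPad k x| ≤ 2 · 2^{|x|^k}`. [folklore] -/
theorem length_expPad_le {k : ℕ} (hk : 1 ≤ k) (x : List Bool) :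
    (expPad k x).length ≤ 2 * 2 ^ (x.length ^ k) := by
  rw [length_expPad]
  have h1 : x.length + 1 ≤ 2 ^ x.length := Nat.lt_two_pow_self
  have h2 : 2 ^ x.length ≤ 2 ^ (x.length ^ k) :=
    Nat.pow_le_pow_right Nat.two_pos (Nat.le_self_pow (by omega) _)
  omega

/-- **Upward translation (machine form).** If `x ∈ L ↔ expPad k x ∈ L'` and `L'` is decided in
time `t` (monotone), then `L` is decided in time `C · 2^{n^k} + C + t (2 · 2^{n^k})`: pad, then
run the decider of `L'` (sequential composition of the two machines,
`Turing.TM2ComputableAux.comp_outputsWithin`). This is the translation step of all padding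
arguments (Arora–Barak 2009, §2.6.2, proof of Thm. 2.22; Murray–Williams 2017, proof of
Thm. 4.1: "It is enough to show that `L ∈ EXP`"). [cite: AroraBarak2009, Thm. 2.22 (proof)] -/
theorem exists_timeDecidable_of_expPad {L L' : Language Bool} {k : ℕ} (hk : 1 ≤ k) {t : ℕ → ℕ}
    (ht : Monotone t) (hLL' : ∀ x, x ∈ L ↔ expPad k x ∈ L') (hL' : TimeDecidable id L' t) :
    ∃ C : ℕ, TimeDecidable id L (fun n => C * 2 ^ (n ^ k) + C + t (2 * 2 ^ (n ^ k))) := by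
  obtain ⟨C, Mp, hMp⟩ := exists_timeComputable_expPad hk
  obtain ⟨M', hM'⟩ := hL'
  refine ⟨C, Mp.comp M', fun x => ?_⟩
  have hind : L'.boolIndicator (expPad k x) = L.boolIndicator x := by
    rw [Bool.eq_iff_iff, ← Set.mem_iff_boolIndicator, ← Set.mem_iff_boolIndicator]
    exact (hLL' x).symm
  have h := Turing.TM2ComputableAux.comp_outputsWithin Mp M' (hMp x) (hM' (expPad k x))
  rw [hind] at h
  refine h.mono ?_
  simp only [id]
  have := ht (length_expPad_le hk x)
  omega

/-- Arithmetic of the translation: `C · 2^{n^k} + C + (c (2 · 2^{n^k})^j + c) ≤ c' · 2^{n^{k+1}} + c'`.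
[folklore] -/
theorem exists_translation_bound (C c j k : ℕ) (hk : 1 ≤ k) :
    ∃ c' : ℕ, ∀ n : ℕ,
      C * 2 ^ (n ^ k) + C + (c * (2 * 2 ^ (n ^ k)) ^ j + c) ≤ c' * 2 ^ (n ^ (k + 1)) + c' := by
  refine ⟨C + c * (2 ^ j * 2 ^ (j ^ (k + 1))) + c, fun n => ?_⟩
  set A := 2 ^ (n ^ (k + 1)) with hA
  set E := 2 ^ j * 2 ^ (j ^ (k + 1)) with hE
  have h1 : 2 ^ (n ^ k) ≤ A := by
    refine Nat.pow_le_pow_right Nat.two_pos ?_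
    rcases Nat.eq_zero_or_pos n with rfl | hn
    · simp [Nat.pos_iff_ne_zero.mp hk]
    · exact Nat.pow_le_pow_right hn (Nat.le_succ k)
  have h2 : 2 ^ (j * n ^ k) ≤ 2 ^ (j ^ (k + 1)) + 2 ^ (n ^ (k + 1)) := by
    rcases le_or_gt n j with hnj | hjn
    · have : j * n ^ k ≤ j ^ (k + 1) := by
        rw [pow_succ']
        exact Nat.mul_le_mul_left j (Nat.pow_le_pow_left hnj k)
      exact le_add_right (Nat.pow_le_pow_right Nat.two_pos this)
    · have : j * n ^ k ≤ n ^ (k + 1) := by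
        rw [pow_succ']
        exact Nat.mul_le_mul_right _ hjn.le
      exact le_add_left (Nat.pow_le_pow_right Nat.two_pos this)
  have h3 : (2 * 2 ^ (n ^ k)) ^ j = 2 ^ j * 2 ^ (j * n ^ k) := by
    rw [mul_pow, ← pow_mul, mul_comm (n ^ k) j]
  rw [h3]
  have h4 : 2 ^ j * 2 ^ (j * n ^ k) ≤ E + 2 ^ j * A := by
    rw [hE, ← mul_add]; exact Nat.mul_le_mul_left _ h2
  have h5 : 2 ^ j ≤ E := Nat.le_mul_of_pos_right _ Nat.one_le_two_pow
  have hcoef : C + c * 2 ^ j ≤ C + c * E + c :=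
    le_add_right (Nat.add_le_add_left (Nat.mul_le_mul_left c h5) C)
  calc C * 2 ^ (n ^ k) + C + (c * (2 ^ j * 2 ^ (j * n ^ k)) + c)
      ≤ C * A + C + (c * (E + 2 ^ j * A) + c) := by gcongr
    _ = (C + c * 2 ^ j) * A + (C + c * E + c) := by ring
    _ ≤ (C + c * E + c) * A + (C + c * E + c) :=
        Nat.add_le_add_right (Nat.mul_le_mul_right A hcoef) _

/-- **Upward translation (class form).** If `x ∈ L ↔ expPad k x ∈ L'` (`1 ≤ k`) and
`L' ∈ DTIME(n^j)`, then `L ∈ DTIME(2^{n^{k+1}})`. [cite: AroraBarak2009, Thm. 2.22 (proof)] -/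
theorem mem_DTIME_of_expPad {L L' : Language Bool} {k j : ℕ} (hk : 1 ≤ k)
    (hLL' : ∀ x, x ∈ L ↔ expPad k x ∈ L') (hL' : L' ∈ DTIME fun n => n ^ j) :
    L ∈ DTIME fun n => 2 ^ (n ^ (k + 1)) := by
  obtain ⟨c, hc⟩ := hL'
  have hmono : Monotone fun n : ℕ => c * n ^ j + c := fun a b hab => by
    simp only
    exact Nat.add_le_add_right (Nat.mul_le_mul_left c (Nat.pow_le_pow_left hab j)) c
  obtain ⟨C, hC⟩ := exists_timeDecidable_of_expPad hk hmono hLL' hc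
  obtain ⟨c', hc'⟩ := exists_translation_bound C c j k hk
  obtain ⟨M, hM⟩ := hC
  exact ⟨c', M, hM.mono fun x => hc' x.length⟩

/-- **Upward translation for `P` and `EXP`.** If `x ∈ L ↔ expPad k x ∈ L'` (`1 ≤ k`) and
`L' ∈ P`, then `L ∈ EXP` ("It is enough to show that `L ∈ EXP`", Murray–Williams 2017, proof
of Thm. 4.1; Arora–Barak 2009, proof of Thm. 2.22). [cite: AroraBarak2009, Thm. 2.22 (proof)] -/
theorem mem_EXP_of_expPad {L L' : Language Bool} {k : ℕ} (hk : 1 ≤ k)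
    (hLL' : ∀ x, x ∈ L ↔ expPad k x ∈ L') (hL' : L' ∈ Classes.P) : L ∈ EXP := by
  simp only [Classes.P, Set.mem_iUnion] at hL'
  obtain ⟨j, hj⟩ := hL'
  simp only [EXP, Set.mem_iUnion]
  exact ⟨k + 1, mem_DTIME_of_expPad hk hLL' hj⟩

/-- **A language whose padded version is in `P` is in `EXP`.**
[cite: AroraBarak2009, Thm. 2.22 (proof)] -/
theorem mem_EXP_of_padLang_mem_P {L : Language Bool} {k : ℕ} (hk : 1 ≤ k)
    (h : padLang k L ∈ Classes.P) : L ∈ EXP :=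
  mem_EXP_of_expPad hk (fun _ => expPad_mem_padLang_iff.symm) h

end Literature.Computability.Complexity
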